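import Summits.CriticalPhenomena.Ising3DConformalLimit.Theorems.LeeYangGapNearCriticalLeeYangGapReduction
import Summits.CriticalPhenomena.Ising3DConformalLimit.Theorems.PerfectScreeningCoulombImpliesNontrivialOfUpperCriticalIsotherm

/-!
# Near-critical Lee–Yang gap — the CUBE-GAP funnel of line `registered`

Route `LeeYangGap` (Ising3DConformalLimit), crux `NearCriticalLeeYangGap` (GAP, item
stmt-CriticalPhenomena-4945), line `registered`. The landed composition of the line
(`stub_gapOfEdgeRateOneScale`, file `LeeYangGapNearCriticalLeeYangGapReduction.lean`: EDGE + S1r +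
S2χ₁ ⇒ GAP) factors through ONE statement about classical partition-function zeros, the

**cube gap** (CG): `∃ C, ∃ᶠ L, ∃ β ∈ [0, β_c(3)], α₁(Λ_L,β)² · Σ_L ≤ C` — for infinitely many `L`
the first Lee–Yang zero `α₁(Λ_L,β) = JiangNewman.firstZero 3 (box 3 L) β` of the FREE CUBE `Λ_L` at
some `β ≤ β_c` (the first zero of `θ ↦ Z^free_{Λ_L,β}(iθ)/Z^free_{Λ_L,β}(0)`) is `O(Σ_L^{-1/2})`,
`Σ_L = ⟨M_L²⟩_{β_c}` the CRITICAL infinite-volume block variance.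

This file lands the two halves of that factorisation, both registered glue stubs of the item
(exact registered signatures, sorry-free):

* `stub_gapOfCubeGap` : (CG) → GAP — the transfer: S1a (`α₁(Λ_L,β) > 0` is a zero of the free
  cube's `⟨cos θM_L⟩`), S1v (Camia–Jiang–Newman in the volume: zeros `≤ α₁` of the block in every
  larger free box), S1t (a zero `θ' ∈ (0, α₁]` of the infinite-volume block characteristic function,
  `0 ≤ β ≤ β_c`), and `θ'²Σ_L ≤ α₁²Σ_L ≤ C` since `Σ_L > 0` (landed `sketchPub_blockVariance_pos`);
* `stub_cubeGapOfEdgeRateOneScale` : EDGE → S1r → S2χ₁ → (CG) — the near-critical half of the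
  landed composition (S1u: `β ↑ β_c` with `ξ(β) → ∞`, `L := ⌈K₀ξ(β)⌉₊`; S1r + S1e: `m(β,·)` analytic
  on `{|Im h| < cα₁/A}`; EDGE: `(cα₁/A)²χξ³ ≤ C₁`; S2 = S2g (S2d S2χ₁): `Σ_L ≤ Bχξ³`; hence
  `α₁²Σ_L ≤ (A/c)²BC₁`), with EDGE = route item `YangLeeEdgeHyperscaling` (stmt-CriticalPhenomena-4946)
  BY NAME and the two open cores S1r (`stub_firstZeroRate`), S2χ₁
  (`stub_susceptibilityComparabilityOneScale`) verbatim as hypotheses — nothing open is proved,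
  assumed as an axiom, or restated as a definition.

So the line's three open statements (EDGE, S1r, S2χ₁) are used ONLY to produce (CG), and (CG) alone
— a statement on free cubes, `β ≤ β_c` free to choose (at `β = β_c` it reads: the first
partition-function zero of the critical free cube is `O(Σ_L^{-1/2})`, the lower half of the
Itzykson–Pearson–Zuber finite-size scaling `h₁(L) ≍ L^{-y_h}`) — already implies the crux by landed
theorems. (CG) is formally stronger than GAP (the infinite-volume first zero lies below the cube's, by
Camia–Jiang–Newman monotonicity) and, like GAP, is a `d = 3` non-triviality statement: false for
`d ≥ 5`, open on `ℤ³`.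

Notation: `Λ_L = box 3 L`, `ξ(β) = isingCorrLength 3 β`, `χ(β) = susceptibility 3 β` (`.toReal`),
`m(β,h) = magnetizationInField 3 β h`, `Σ_L = plusExpect 3 β_c 0 (M_L²)`.

## References

* C. Itzykson, R. B. Pearson, J. B. Zuber, Nucl. Phys. B220 (1983) 415–433 [ItzyksonPearsonZuber1983].
* F. Camia, J. Jiang, C. M. Newman, arXiv:2207.12247, Thm. 2 [CamiaJiangNewman2023];
  J. Jiang, C. M. Newman, CPAM 77 (2024), Thm. 1 [JiangNewman2023].
* C. M. Newman, CPAM 27 (1974); CMP 41 (1975) [Newman1975] (Lee–Yang class: `θ₁²·Var ≥ 2`,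
  `12θ₁⁻⁴ ≤ |κ₄| ≤ 6θ₁⁻²Var`).
-/

noncomputable section

namespace Summit.CriticalPhenomena.Ising3DConformalLimit.LeeYangGapNearCriticalLeeYangGap

open Filter
open Literature.Probability.LatticeModels
open Summit.CriticalPhenomena.Ising3DConformalLimit.Theses.LeeYangGap
  (NearCriticalLeeYangGap YangLeeEdgeHyperscaling)
open Summit.CriticalPhenomena.Ising3DConformalLimit.PerfectScreeningCoulombImpliesNontrivial
  (sketchPub_blockVariance_pos)

/-! ### (CG) → GAP -/

/- Positivity of the critical block variance `Σ_L = ⟨M_L²⟩_{β_c}` (`Σ_L ≥ 1`, Griffiths) is the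
landed `PerfectScreeningCoulombImpliesNontrivial.sketchPub_blockVariance_pos` (opened above). -/

/-- **Transfer of a cube zero to the infinite-volume block, with the yardstick.** If `0 ≤ β ≤ β_c(3)`
and `α₁(Λ_L,β)²·Σ_L ≤ C`, then the infinite-volume block characteristic function `θ ↦ ⟨cos θM_L⟩_β`
has a zero `θ' > 0` with `θ'²·Σ_L ≤ C` (S1a: `α₁ > 0` is a cube zero; S1v: zeros `≤ α₁` in all
larger free boxes; S1t: an infinite-volume zero `θ' ≤ α₁`; `Σ_L > 0`). -/
theorem exists_blockZero_sq_mul_le_of_cubeZero {L : ℕ} {β C : ℝ} (h0β : 0 ≤ β)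
    (hββc : β ≤ criticalBeta 3)
    (hC : JiangNewman.firstZero 3 (box 3 L) β ^ 2 *
      plusExpect 3 (criticalBeta 3) 0 (fun σ => (∑ x ∈ box 3 L, spinAt x σ) ^ 2) ≤ C) :
    ∃ θ' : ℝ, 0 < θ' ∧ θ' ^ 2 *
      plusExpect 3 (criticalBeta 3) 0 (fun σ => (∑ x ∈ box 3 L, spinAt x σ) ^ 2) ≤ C ∧
      plusExpect 3 β 0 (fun σ => Real.cos (θ' * ∑ x ∈ box 3 L, spinAt x σ)) = 0 := by
  obtain ⟨hαpos, hαzero⟩ := stub_firstZeroAttained L β h0β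
  have hfin : ∀ N : ℕ, L ≤ N → ∃ t : ℝ, 0 < t ∧ t ≤ JiangNewman.firstZero 3 (box 3 L) β ∧
      isingExpect (zdGraph 3) (box 3 N) β 0 .free
        (fun σ => Real.cos (t * ∑ x ∈ box 3 L, spinAt x σ)) = 0 :=
    fun N hLN => stub_cubeZeroToFreeBox L N β _ hLN h0β hαpos hαzero
  obtain ⟨θ', hθ'pos, hθ'le, hzero⟩ := stub_blockZeroOfFreeBoxZeros L β _ h0β hββc hαpos hfin
  refine ⟨θ', hθ'pos, le_trans ?_ hC, hzero⟩
  have hsq : θ' ^ 2 ≤ JiangNewman.firstZero 3 (box 3 L) β ^ 2 :=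
    pow_le_pow_left₀ hθ'pos.le hθ'le 2
  exact mul_le_mul_of_nonneg_right hsq (sketchPub_blockVariance_pos L).le

/-- **`stub_gapOfCubeGap` — (CG) → GAP** (registered glue stub of line `registered`, verbatim): if
for infinitely many `L` some `β ∈ [0, β_c(3)]` has `α₁(Λ_L,β)²·Σ_L ≤ C` (first Lee–Yang zero of the
free cube against the critical block variance), then `NearCriticalLeeYangGap` holds with the same `C`
(transfer `exists_blockZero_sq_mul_le_of_cubeZero` inside `Frequently.mono`). -/
theorem stub_gapOfCubeGap :
    (∃ C : ℝ, ∃ᶠ L : ℕ in Filter.atTop, ∃ β : ℝ, 0 ≤ β ∧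
      β ≤ Literature.Probability.LatticeModels.criticalBeta 3 ∧
      Literature.Probability.LatticeModels.JiangNewman.firstZero 3
          (Literature.Probability.LatticeModels.box 3 L) β ^ 2 *
        Literature.Probability.LatticeModels.plusExpect 3
          (Literature.Probability.LatticeModels.criticalBeta 3) 0
          (fun σ => (∑ x ∈ Literature.Probability.LatticeModels.box 3 L,
            Literature.Probability.LatticeModels.spinAt x σ) ^ 2) ≤ C) →
    Summit.CriticalPhenomena.Ising3DConformalLimit.Theses.LeeYangGap.NearCriticalLeeYangGap := by
  rintro ⟨C, hfreq⟩
  refine ⟨C, hfreq.mono fun L hL => ?_⟩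
  obtain ⟨β, h0β, hββc, hC⟩ := hL
  obtain ⟨θ', hθ'pos, hle, hzero⟩ := exists_blockZero_sq_mul_le_of_cubeZero h0β hββc hC
  exact ⟨β, θ', h0β, hββc, hθ'pos, hle, hzero⟩

/-! ### EDGE + S1r + S2χ₁ → (CG) -/

/-- **EDGE + S1r + S2χ₁ ⇒ (CG)** (named-hypothesis form): `YangLeeEdgeHyperscaling` (item 4946, by
name), the first-zero rate S1r and the one-scale susceptibility comparability S2χ₁ (registered stub
statements, verbatim) give, for every `L₀`, a block size `L ≥ L₀` and a `β ∈ [0, β_c)` with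
`α₁(Λ_L,β)²·Σ_L ≤ (A/c)²BC₁`: S1u picks `β ∈ [β₁,β_c)` with `ξ(β) ≥ max 1 (L₀/K₀+1)`
(`β₁ := max(β₀,β₀',β₀'',β₂,β_c/2)`), `L := ⌈K₀ξ(β)⌉₊`; S1a: `α₁ > 0`; S1r: `α₁/A ≤ α₁(Λ_n,β)` for all
`n`; S1e: `m(β,·)` analytic on `{|Im h| < cα₁/A}`; EDGE: `(α₁/(A/c))²χξ³ ≤ C₁`; S2 = S2g (S2d S2χ₁) at
window constant `K₀+1`: `Σ_L ≤ Bχξ³`; bookkeeping `gap_sq_mul_le_of_window_of_edge`. -/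
theorem cubeGap_of_edge_of_firstZeroRate_of_oneScale
    (hE : YangLeeEdgeHyperscaling)
    (hR : ∃ A K₀ β₀ : ℝ, 0 < A ∧ 0 < K₀ ∧ β₀ < Literature.Probability.LatticeModels.criticalBeta 3 ∧
      ∀ β : ℝ, β₀ ≤ β → β < Literature.Probability.LatticeModels.criticalBeta 3 → ∀ L : ℕ,
        K₀ * Literature.Probability.LatticeModels.isingCorrLength 3 β ≤ (L : ℝ) → ∀ n : ℕ,
          Literature.Probability.LatticeModels.JiangNewman.firstZero 3
              (Literature.Probability.LatticeModels.box 3 L) β ≤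
            A * Literature.Probability.LatticeModels.JiangNewman.firstZero 3
              (Literature.Probability.LatticeModels.box 3 n) β)
    (hχ₁ : ∃ r A β₂ : ℝ, 0 < r ∧ 0 < A ∧ β₂ < Literature.Probability.LatticeModels.criticalBeta 3 ∧
      ∀ β : ℝ, β₂ ≤ β → β < Literature.Probability.LatticeModels.criticalBeta 3 → ∀ n : ℕ,
        (n : ℝ) ≤ r * Literature.Probability.LatticeModels.isingCorrLength 3 β →
        ∑ z ∈ Literature.Probability.LatticeModels.box 3 n,
            Literature.Probability.LatticeModels.twoPointPlus 3
              (Literature.Probability.LatticeModels.criticalBeta 3) z ≤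
          A * (Literature.Probability.LatticeModels.susceptibility 3 β).toReal) :
    ∃ C : ℝ, ∃ᶠ L : ℕ in Filter.atTop, ∃ β : ℝ, 0 ≤ β ∧ β ≤ criticalBeta 3 ∧
      JiangNewman.firstZero 3 (box 3 L) β ^ 2 *
        plusExpect 3 (criticalBeta 3) 0 (fun σ => (∑ x ∈ box 3 L, spinAt x σ) ^ 2) ≤ C := by
  -- S2χ := S2d S2χ₁ (landed p155937), S2 := S2g S2χ at window constant `K₀ + 1` (landed p149939)
  have hχ := stub_susceptibilityComparability_of_oneScale hχ₁
  obtain ⟨C₁, β₀, hβ₀, hE⟩ := hE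
  obtain ⟨A, K₀, β₀', hApos, hK₀, hβ₀', hR⟩ := hR
  -- S1e (landed p154953)
  obtain ⟨c, β₀'', hc, hβ₀'', hA⟩ := stub_edgeAnalyticity
  obtain ⟨B, β₂, hB, hβ₂, hW⟩ :=
    stub_criticalWindowVariance_of_susceptibilityComparability hχ (K₀ + 1) (by positivity)
  have hβc : 0 < criticalBeta 3 := criticalBeta_pos_holds (d := 3) (by norm_num)
  have hβ₁ : max (max (max (max β₀ β₀') β₀'') β₂) (criticalBeta 3 / 2) < criticalBeta 3 :=
    max_lt (max_lt (max_lt (max_lt hβ₀ hβ₀') hβ₀'') hβ₂) (by linarith)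
  refine ⟨(A / c) ^ 2 * B * C₁, Filter.frequently_atTop.2 fun L₀ => ?_⟩
  -- S1u (landed p149697): a `β ∈ [β₁, β_c)` with a large correlation length
  obtain ⟨β, hβ₁β, hββc, hξ⟩ := stub_corrLengthUnbounded
    (max (max (max (max β₀ β₀') β₀'') β₂) (criticalBeta 3 / 2)) (max 1 ((L₀ : ℝ) / K₀ + 1)) hβ₁
  have hm4 : max (max (max β₀ β₀') β₀'') β₂ ≤ β := le_trans (le_max_left _ _) hβ₁β
  have hm3 : max (max β₀ β₀') β₀'' ≤ β := le_trans (le_max_left _ _) hm4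
  have hm2 : max β₀ β₀' ≤ β := le_trans (le_max_left _ _) hm3
  have hβ₀β : β₀ ≤ β := le_trans (le_max_left _ _) hm2
  have hβ₀'β : β₀' ≤ β := le_trans (le_max_right _ _) hm2
  have hβ₀''β : β₀'' ≤ β := le_trans (le_max_right _ _) hm3
  have hβ₂β : β₂ ≤ β := le_trans (le_max_right _ _) hm4
  have hβpos : 0 < β := lt_of_lt_of_le (by linarith) (le_trans (le_max_right _ _) hβ₁β)
  have h0β : 0 ≤ β := hβpos.le
  obtain ⟨hL₀L, hKξL, hLKξ⟩ := gap_blockSize_window (L₀ := L₀) hK₀ (le_trans (le_max_left _ _) hξ)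
    (le_trans (le_max_right _ _) hξ)
  -- S1a (landed p153649): positivity of the cube zero
  obtain ⟨hαpos, -⟩ := stub_firstZeroAttained ⌈K₀ * isingCorrLength 3 β⌉₊ β h0β
  -- S1r (hypothesis): rate; S1e: strip analyticity; then EDGE (hypothesis)
  have hw : ∀ n : ℕ, JiangNewman.firstZero 3 (box 3 ⌈K₀ * isingCorrLength 3 β⌉₊) β / A ≤
      JiangNewman.firstZero 3 (box 3 n) β := fun n => by
    have h := hR β hβ₀'β hββc _ hKξL n
    rw [div_le_iff₀ hApos]
    linarith [h]
  obtain ⟨F, hF, hFm⟩ := hA β hβ₀''β hββc _ (div_pos hαpos hApos) hw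
  have hEdge := hE β (c * (JiangNewman.firstZero 3 (box 3 ⌈K₀ * isingCorrLength 3 β⌉₊) β / A))
    hβ₀β hββc (by positivity) ⟨F, hF, hFm⟩
  have heq : c * (JiangNewman.firstZero 3 (box 3 ⌈K₀ * isingCorrLength 3 β⌉₊) β / A) =
      JiangNewman.firstZero 3 (box 3 ⌈K₀ * isingCorrLength 3 β⌉₊) β / (A / c) := by
    rw [div_div_eq_mul_div]; ring
  rw [heq] at hEdge
  -- S2 at `(β, L)` (critical-window variance) and the bookkeeping
  have hVar := hW β hβ₂β hββc _ hLKξ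
  exact ⟨_, hL₀L, β, h0β, hββc.le,
    gap_sq_mul_le_of_window_of_edge (div_pos hApos hc) hB hVar hEdge⟩

/-- **`stub_cubeGapOfEdgeRateOneScale` — EDGE → S1r → S2χ₁ → (CG)** (registered glue stub of line
`registered`, verbatim): the near-critical half of the line's composition, i.e.
`cubeGap_of_edge_of_firstZeroRate_of_oneScale` with anonymous hypotheses; composed with
`stub_gapOfCubeGap` it re-proves the landed `stub_gapOfEdgeRateOneScale`. -/
theorem stub_cubeGapOfEdgeRateOneScale :
    Summit.CriticalPhenomena.Ising3DConformalLimit.Theses.LeeYangGap.YangLeeEdgeHyperscaling →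
    (∃ A K₀ β₀ : ℝ, 0 < A ∧ 0 < K₀ ∧ β₀ < Literature.Probability.LatticeModels.criticalBeta 3 ∧
      ∀ β : ℝ, β₀ ≤ β → β < Literature.Probability.LatticeModels.criticalBeta 3 → ∀ L : ℕ,
        K₀ * Literature.Probability.LatticeModels.isingCorrLength 3 β ≤ (L : ℝ) → ∀ n : ℕ,
          Literature.Probability.LatticeModels.JiangNewman.firstZero 3
              (Literature.Probability.LatticeModels.box 3 L) β ≤
            A * Literature.Probability.LatticeModels.JiangNewman.firstZero 3
              (Literature.Probability.LatticeModels.box 3 n) β) →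
    (∃ r A β₂ : ℝ, 0 < r ∧ 0 < A ∧ β₂ < Literature.Probability.LatticeModels.criticalBeta 3 ∧
      ∀ β : ℝ, β₂ ≤ β → β < Literature.Probability.LatticeModels.criticalBeta 3 → ∀ n : ℕ,
        (n : ℝ) ≤ r * Literature.Probability.LatticeModels.isingCorrLength 3 β →
        ∑ z ∈ Literature.Probability.LatticeModels.box 3 n,
            Literature.Probability.LatticeModels.twoPointPlus 3
              (Literature.Probability.LatticeModels.criticalBeta 3) z ≤
          A * (Literature.Probability.LatticeModels.susceptibility 3 β).toReal) →
    (∃ C : ℝ, ∃ᶠ L : ℕ in Filter.atTop, ∃ β : ℝ, 0 ≤ β ∧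
      β ≤ Literature.Probability.LatticeModels.criticalBeta 3 ∧
      Literature.Probability.LatticeModels.JiangNewman.firstZero 3
          (Literature.Probability.LatticeModels.box 3 L) β ^ 2 *
        Literature.Probability.LatticeModels.plusExpect 3
          (Literature.Probability.LatticeModels.criticalBeta 3) 0
          (fun σ => (∑ x ∈ Literature.Probability.LatticeModels.box 3 L,
            Literature.Probability.LatticeModels.spinAt x σ) ^ 2) ≤ C) :=
  fun hE hR hχ₁ => cubeGap_of_edge_of_firstZeroRate_of_oneScale hE hR hχ₁

end Summit.CriticalPhenomena.Ising3DConformalLimit.LeeYangGapNearCriticalLeeYangGap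

end
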